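import Mathlib
import HarnessLib
import Literature.Analysis.FluidPDE.ClassicalSolution
import Literature.Analysis.FluidPDE.LerayHopf
import Literature.Analysis.FluidPDE.SuitableWeak
import Literature.Analysis.FluidPDE.TaoLocalisationHolds
import Literature.Analysis.FluidPDE.TaoFiniteEnergyLerayHopf
import Literature.Analysis.FluidPDE.NSVorticityBKMEnergy
import Summits.NavierStokesRegularity.NavierStokesRegularity.Theorems.QuarterJoltSliceTestTransportL4
import Summits.NavierStokesRegularity.NavierStokesRegularity.Theorems.QuarterJoltL4SliceTestCriterion
import Summits.NavierStokesRegularity.NavierStokesRegularity.Theorems.CertifiedBlowupCertifiedBlowupAxisymBlowupEnergyDrain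
import Literature.MathematicalPhysics.KineticTheory.DiPernaLionsExpDuhamel

/-!
# Route QuarterJolt — crux `NoTerminalJolt` (stmt-NavierStokesRegularity-26463), LEAD line
# `regular_split` rev 8: A DISSIPATION TAIL `∫ₜᵀ∫|∇u|² ≤ K(T−t)^γ`, `γ > 1/5`, FORCES THE ENERGY
# EQUALITY AT `T` — energy `γ`-Hölder from the left at a first blow-up ⇒ energy continuous there

Seat ns-ntj-p1 g6 (LEAD of the crux; `--supports 26463 --as helper`). Frame: `(u,p)` classical on
`[0,T)` (`ν, T > 0`), Leray–Hopf on `[0,T]` from a rapidly decaying datum; `Z(t) = ∫|Du(t)|²_F`,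
`F(t) = ∫⁻ ofReal |Du(t)|²_F`, `D(t) = ∫⁻_{(t,T)} F` the dissipation tail (`= (E(u t) − E(T⁻))/ν`).

THE THEOREM (`tendsto_integral_norm_sub_sq_of_dissipationRate`): `D(t) ≤ K(T−t)^γ` near `T` with
`γ > 1/5` ⇒ `∫‖u(t) − u(T)‖² → 0` as `t ↑ T` (no energy jump). The INTEGRATED, intermittency-tolerant
form of rev 5's enstrophy-rate theorem (`α < 4/5 ⟺ γ = 1 − α > 1/5`, p641804); `γ = 1/2` is the
window quarter law `EnergyHalfHolder` of route HalfHolderEnergy (stmt-25161; edges: companion file).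
Proof (master form of the `L⁴` criterion, p652789): (1) Young `a^{3/4} ≤ (3/4)λa + (1/4)λ^{−3}` and
Ladyzhenskaya give `∫⁻_{(t,s)} ofReal ‖u‖²_{L⁴} ≤ ofReal(3cλ/4)·∫⁻_{(t,s)}F + ofReal(cλ^{−3}(s−t)/4)`,
`c = K_L^{3/2}(2E₀)^{1/4}`; (2) CHEBYSHEV IN TIME: a slice `τ ∈ (t,(t+T)/2)` with
`Z(τ) < 4(K+1)(T−t)^{γ−1}`; (3) `λ = (T−τ)^{(1−γ)/4}`: `∫_τᵀ‖u‖²_{L⁴} ≲ (T−τ)^{(1+3γ)/4}`, so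
`√Z(τ)∫_τᵀ‖u‖²_{L⁴} ≲ (T−τ)^{(5γ−1)/4} → 0` iff `γ > 1/5`. The ENERGY-HÖLDER form and the typed
edges (stmt-25161 ⇒ stmt-18118) are in the companion file `QuarterJoltEnergyHalfHolderEdges.lean`.

HONEST FRAMING: conditional criteria at a first blow-up time; nothing here claims progress on
`NoTerminalJolt`, stmt-18118, stmt-25161 or Navier–Stokes regularity — all OPEN. No summit statement
is proved here. [folklore]
-/

noncomputable section

-- the summit and its single sub-problem share the name (CONVENTIONS §1), as in every Theorems file
set_option linter.dupNamespace false

namespace Summit.NavierStokesRegularity.NavierStokesRegularity.Theorems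

open MeasureTheory Set Function Filter Topology InnerProductSpace
open scoped ENNReal NNReal ContDiff RealInnerProductSpace
open Literature.Analysis.FluidPDE

namespace NoTerminalJolt

/-! ### Tools -/

/-- **Young with weights `3/4, 1/4`**: `a^{3/4} ≤ (3/4)λa + (1/4)λ^{−3}` for `a ≥ 0`, `λ > 0`
(weighted AM–GM for `λa` and `λ^{−3}`). [folklore] -/
theorem rpow_three_quarters_le_young {a lam : ℝ} (ha : 0 ≤ a) (hlam : 0 < lam) :
    a ^ (3 / 4 : ℝ) ≤ 3 / 4 * (lam * a) + 1 / 4 * lam ^ (-3 : ℝ) := by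
  have h := Real.geom_mean_le_arith_mean2_weighted (w₁ := 3 / 4) (w₂ := 1 / 4) (p₁ := lam * a)
    (p₂ := lam ^ (-3 : ℝ)) (by norm_num) (by norm_num) (by positivity)
    (Real.rpow_nonneg hlam.le _) (by norm_num)
  have e : (lam * a) ^ (3 / 4 : ℝ) * (lam ^ (-3 : ℝ)) ^ (1 / 4 : ℝ) = a ^ (3 / 4 : ℝ) := by
    rw [Real.mul_rpow hlam.le ha, ← Real.rpow_mul hlam.le,
      show (-3 : ℝ) * (1 / 4) = -(3 / 4) by norm_num, mul_comm (lam ^ (3 / 4 : ℝ)), mul_assoc,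
      ← Real.rpow_add hlam, show (3 / 4 : ℝ) + -(3 / 4) = 0 by norm_num, Real.rpow_zero, mul_one]
  rwa [e] at h

/-! ### The `L⁴` tail through Ladyzhenskaya and Young, on a sub-slab -/

/-- **`∫⁻_{(t,s)} ofReal ‖u(τ)‖²_{L⁴} ≤ ofReal(3cλ/4)·∫⁻_{(t,s)}∫⁻|Du|²_F + ofReal(cλ^{−3}(s−t)/4)`**
on a sub-slab `0 < t < s < T` of the frame, for every `λ > 0`, with `c = K_L^{3/2}(2E(u 0))^{1/4}`
(`K_L` Mathlib's Sobolev constant): Ladyzhenskaya `‖u(τ)‖²_{L⁴} ≤ K_L^{3/2}‖u(τ)‖₂^{1/2}Z(τ)^{3/4}`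
(`sqrt_integral_norm_pow_four_le`, p640762; Tao's class on the closed slab `[0,(s+T)/2]`), the energy
bound, and `Z^{3/4} ≤ (3/4)λZ + (1/4)λ^{−3}`. [folklore] -/
theorem lintegral_sqrt_l4_le_of_young {ν T : ℝ} (hν : 0 < ν) (hT : 0 < T)
    {u : ℝ → EuclideanSpace ℝ (Fin 3) → EuclideanSpace ℝ (Fin 3)} {p : ℝ → EuclideanSpace ℝ (Fin 3) → ℝ}
    (hcl : IsClassicalNSSolutionOn (Ico 0 T) ν 0 u p) (hLH : IsLerayHopfOn T ν 0 (u 0) u)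
    (hdec : HasRapidSpatialDecay (u 0)) {t s : ℝ} (ht : 0 < t) (hts : t < s) (hsT : s < T)
    {lam : ℝ} (hlam : 0 < lam) :
    ∫⁻ τ in Ioo t s, ENNReal.ofReal (Real.sqrt (∫ x, ‖u τ x‖ ^ 4)) ≤
      ENNReal.ofReal ((SNormLESNormFDerivOfEqConst (EuclideanSpace ℝ (Fin 3))
            (volume : Measure (EuclideanSpace ℝ (Fin 3))) 2 : ℝ) ^ (3 / 2 : ℝ) *
          (2 * VectorCalculus.kineticEnergy (u 0)) ^ (1 / 4 : ℝ) * (3 / 4 * lam)) *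
        (∫⁻ τ in Ioo t s, ∫⁻ x, ENNReal.ofReal (frobeniusNormSq (fderiv ℝ (u τ) x))) +
      ENNReal.ofReal ((SNormLESNormFDerivOfEqConst (EuclideanSpace ℝ (Fin 3))
            (volume : Measure (EuclideanSpace ℝ (Fin 3))) 2 : ℝ) ^ (3 / 2 : ℝ) *
          (2 * VectorCalculus.kineticEnergy (u 0)) ^ (1 / 4 : ℝ) * (1 / 4 * lam ^ (-3 : ℝ)) *
          (s - t)) := by
  set Kc : ℝ := (SNormLESNormFDerivOfEqConst (EuclideanSpace ℝ (Fin 3))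
    (volume : Measure (EuclideanSpace ℝ (Fin 3))) 2 : ℝ) with hKc
  have hKc0 : 0 ≤ Kc := NNReal.coe_nonneg _
  set E₀ : ℝ := VectorCalculus.kineticEnergy (u 0) with hE₀
  have hE₀0 : 0 ≤ E₀ := kineticEnergy_nonneg (u 0)
  set c : ℝ := Kc ^ (3 / 2 : ℝ) * (2 * E₀) ^ (1 / 4 : ℝ) with hc
  have hc0 : 0 ≤ c := by positivity
  -- Tao's class on the closed slab `[0,S]`, `S = (s+T)/2`
  set S : ℝ := (s + T) / 2 with hSdef
  have hsS : s < S := by rw [hSdef]; linarith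
  have hST : S < T := by rw [hSdef]; linarith
  have hS : 0 < S := (ht.trans hts).trans hsS
  have hsolS : IsClassicalNSSolutionOn (Icc 0 S) ν 0 u p :=
    hcl.mono (Icc_subset_Ico_right hST) (uniqueDiffOn_Icc hS)
  have hE' : ∃ C' : ℝ≥0, ∀ τ ∈ Icc 0 S, ∫⁻ x, ‖u τ x‖ₑ ^ 2 ≤ C' :=
    ⟨(ENNReal.ofReal (2 * VectorCalculus.kineticEnergy (u 0))).toNNReal, fun τ hτ => by
      rw [ENNReal.coe_toNNReal ENNReal.ofReal_ne_top]
      exact hLH.lintegral_enorm_sq_le hν.le ⟨hτ.1, hτ.2.trans hST.le⟩⟩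
  have hB : HasBoundedSobolevNormsOn (Icc 0 S) u :=
    tao2011_hasBoundedSobolevNormsOn_holds hν hS hsolS hE' hdec
  have hu : ∀ τ ∈ Icc 0 S, ContDiff ℝ ∞ (u τ) := fun τ hτ => hsolS.contDiff_velocity hτ
  obtain ⟨B₀, -, hB₀⟩ := exists_forall_norm_iteratedFDeriv_le_bkmClass hu hB 0
  have huB : ∀ τ ∈ Icc 0 S, ∀ x, ‖u τ x‖ ≤ B₀ := fun τ hτ x => by
    have := hB₀ τ hτ x; rwa [norm_iteratedFDeriv_zero] at this
  obtain ⟨C₀, hC₀⟩ := hB 0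
  obtain ⟨C₁, hC₁⟩ := hB 1
  -- pointwise bound on `(t,s)`
  set F : ℝ → ℝ≥0∞ := fun τ => ∫⁻ x, ENNReal.ofReal (frobeniusNormSq (fderiv ℝ (u τ) x)) with hF
  have hpt : ∀ τ ∈ Ioo t s, ENNReal.ofReal (Real.sqrt (∫ x, ‖u τ x‖ ^ 4)) ≤
      ENNReal.ofReal (c * (3 / 4 * lam)) * F τ + ENNReal.ofReal (c * (1 / 4 * lam ^ (-3 : ℝ))) := by
    intro τ hτ
    have hτS : τ ∈ Icc 0 S := ⟨(ht.trans hτ.1).le, (hτ.2.trans hsS).le⟩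
    have hτT : τ ∈ Icc 0 T := ⟨hτS.1, hτS.2.trans hST.le⟩
    have hv1 : ContDiff ℝ 1 (u τ) := (hu τ hτS).of_le (by norm_cast)
    have l2v : ∫⁻ x, ‖u τ x‖ₑ ^ 2 < ⊤ := by
      refine lt_of_le_of_lt (le_of_eq (lintegral_congr fun x => ?_))
        ((hC₀ τ hτS).trans_lt ENNReal.coe_lt_top)
      rw [← ofReal_norm, ← ofReal_norm, norm_iteratedFDeriv_zero]
    have l2Dv : ∫⁻ x, ‖fderiv ℝ (u τ) x‖ₑ ^ 2 < ⊤ :=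
      lintegral_enorm_sq_lt_top_of_norm_le (fun x => by
        rw [← norm_iteratedFDeriv_fderiv, norm_iteratedFDeriv_zero])
        ((hC₁ τ hτS).trans_lt ENNReal.coe_lt_top)
    have hLad := sqrt_integral_norm_pow_four_le hv1 (huB τ hτS) l2v l2Dv
    rw [← hKc] at hLad
    set Z : ℝ := ∫ x, frobeniusNormSq (fderiv ℝ (u τ) x) with hZdef
    have hZ0 : 0 ≤ Z := integral_nonneg fun x => frobeniusNormSq_nonneg _
    -- energy bound `∫‖u τ‖² ≤ 2E₀`
    have hEτ : ∫ x, ‖u τ x‖ ^ 2 ≤ 2 * E₀ := by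
      have h := CertifiedBlowupAxisymBlowup.EnergyDrain.kineticEnergy_antitoneOn hν hcl hLH
        ⟨le_rfl, hT.le⟩ hτT hτT.1
      have h2 : ∫ x, ‖u τ x‖ ^ 2 = 2 * VectorCalculus.kineticEnergy (u τ) := by
        simp only [VectorCalculus.kineticEnergy]; ring
      rw [h2, hE₀]; simp only at h; linarith
    have hA : (∫ x, ‖u τ x‖ ^ 2) ^ (1 / 4 : ℝ) ≤ (2 * E₀) ^ (1 / 4 : ℝ) :=
      Real.rpow_le_rpow (integral_nonneg fun x => by positivity) hEτ (by norm_num)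
    have h1 : Real.sqrt (∫ x, ‖u τ x‖ ^ 4) ≤ c * Z ^ (3 / 4 : ℝ) := by
      refine hLad.trans ?_
      rw [hc]
      exact mul_le_mul_of_nonneg_right (mul_le_mul_of_nonneg_left hA (by positivity))
        (by positivity)
    have h2 : c * Z ^ (3 / 4 : ℝ) ≤ c * (3 / 4 * lam) * Z + c * (1 / 4 * lam ^ (-3 : ℝ)) := by
      have hy := rpow_three_quarters_le_young hZ0 hlam
      have := mul_le_mul_of_nonneg_left hy hc0
      linarith [this]
    have hZF : ENNReal.ofReal Z ≤ F τ := Literature.MathematicalPhysics.KineticTheory.ofReal_integral_le_lintegral _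
    calc ENNReal.ofReal (Real.sqrt (∫ x, ‖u τ x‖ ^ 4))
        ≤ ENNReal.ofReal (c * (3 / 4 * lam) * Z + c * (1 / 4 * lam ^ (-3 : ℝ))) :=
          ENNReal.ofReal_le_ofReal (h1.trans h2)
      _ = ENNReal.ofReal (c * (3 / 4 * lam)) * ENNReal.ofReal Z +
            ENNReal.ofReal (c * (1 / 4 * lam ^ (-3 : ℝ))) := by
          rw [ENNReal.ofReal_add (by positivity) (by positivity), ENNReal.ofReal_mul (by positivity)]
      _ ≤ ENNReal.ofReal (c * (3 / 4 * lam)) * F τ + ENNReal.ofReal (c * (1 / 4 * lam ^ (-3 : ℝ))) :=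
          add_le_add (mul_le_mul' le_rfl hZF) le_rfl
  calc ∫⁻ τ in Ioo t s, ENNReal.ofReal (Real.sqrt (∫ x, ‖u τ x‖ ^ 4))
      ≤ ∫⁻ τ in Ioo t s, (ENNReal.ofReal (c * (3 / 4 * lam)) * F τ +
          ENNReal.ofReal (c * (1 / 4 * lam ^ (-3 : ℝ)))) :=
        setLIntegral_mono' measurableSet_Ioo fun τ hτ => hpt τ hτ
    _ = ENNReal.ofReal (c * (3 / 4 * lam)) * (∫⁻ τ in Ioo t s, F τ) +
          ENNReal.ofReal (c * (1 / 4 * lam ^ (-3 : ℝ))) * ENNReal.ofReal (s - t) := by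
        rw [lintegral_add_right _ measurable_const, lintegral_const_mul' _ _ ENNReal.ofReal_ne_top,
          setLIntegral_const, Real.volume_Ioo]
    _ = _ := by
        rw [← ENNReal.ofReal_mul (by positivity), hc]

/-! ### THE DISSIPATION-TAIL THEOREM -/

/-- **A DISSIPATION TAIL `∫ₜᵀ∫|∇u|²_F ≤ K(T−t)^γ` WITH `γ > 1/5` FORCES THE ENERGY EQUALITY AT `T`.**
`(u,p)` classical on `[0,T)` (`ν, T > 0`), Leray–Hopf on `[0,T]` from a rapidly decaying datum,
`K ≥ 0`, `1/5 < γ ≤ 1` (a larger `γ` can be traded for `γ = 1` since `T − t ≤ T`), and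
`∫⁻_{(t,T)}∫⁻ ofReal|Du|²_F ≤ ofReal (K(T−t)^γ)` for `t < T` near `T`. Then
`∫‖u(t) − u(T)‖² → 0` as `t ↑ T`. Integrated (intermittency-tolerant) form of the enstrophy-rate
theorem of rev 5 (`α < 4/5 ⟺ γ = 1−α > 1/5`); `γ = 1/2` is the window quarter law of route
HalfHolderEnergy (stmt-25161). Proof: Chebyshev slice `τ ∈ (t,(t+T)/2)` with
`Z(τ) < 4(K+1)(T−t)^{γ−1}`, Ladyzhenskaya–Young tail bound with `λ = (T−τ)^{(1−γ)/4}`, master form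
of the `L⁴` slice-test criterion. [folklore] -/
theorem tendsto_integral_norm_sub_sq_of_dissipationRate {ν T : ℝ} (hν : 0 < ν) (hT : 0 < T)
    {u : ℝ → EuclideanSpace ℝ (Fin 3) → EuclideanSpace ℝ (Fin 3)} {p : ℝ → EuclideanSpace ℝ (Fin 3) → ℝ}
    (hcl : IsClassicalNSSolutionOn (Ico 0 T) ν 0 u p) (hLH : IsLerayHopfOn T ν 0 (u 0) u)
    (hdec : HasRapidSpatialDecay (u 0)) {K γ : ℝ} (hK : 0 ≤ K) (hγ : 1 / 5 < γ) (hγ1 : γ ≤ 1)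
    (hD : ∀ᶠ t in 𝓝[<] T, ∫⁻ τ in Ioo t T, ∫⁻ x, ENNReal.ofReal (frobeniusNormSq (fderiv ℝ (u τ) x)) ≤
      ENNReal.ofReal (K * (T - t) ^ γ)) :
    Tendsto (fun t => ∫ x, ‖u t x - u T x‖ ^ 2) (𝓝[<] T) (𝓝 0) := by
  set Kc : ℝ := (SNormLESNormFDerivOfEqConst (EuclideanSpace ℝ (Fin 3))
    (volume : Measure (EuclideanSpace ℝ (Fin 3))) 2 : ℝ) with hKc
  have hKc0 : 0 ≤ Kc := NNReal.coe_nonneg _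
  set E₀ : ℝ := VectorCalculus.kineticEnergy (u 0) with hE₀
  have hE₀0 : 0 ≤ E₀ := kineticEnergy_nonneg (u 0)
  set c : ℝ := Kc ^ (3 / 2 : ℝ) * (2 * E₀) ^ (1 / 4 : ℝ) with hc
  have hc0 : 0 ≤ c := by positivity
  set K' : ℝ := K + 1 with hK'
  have hK'0 : 0 < K' := by rw [hK']; linarith
  have hγ0 : 0 < γ := by linarith
  -- constants and exponents of the final majorant `Φ(r) = A₁ r^γ + A₂ r^{(5γ−1)/4}`
  set c₁ : ℝ := c * (3 / 4) * K + c * (1 / 4) with hc₁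
  have hc₁0 : 0 ≤ c₁ := by positivity
  set A₁ : ℝ := ν / 2 * (4 * K') with hA₁
  set A₂ : ℝ := 2 * (Real.sqrt (4 * K') * c₁) with hA₂
  set e₂ : ℝ := (5 * γ - 1) / 4 with he₂
  have he₂0 : 0 < e₂ := by rw [he₂]; linarith
  set F : ℝ → ℝ≥0∞ := fun τ => ∫⁻ x, ENNReal.ofReal (frobeniusNormSq (fderiv ℝ (u τ) x)) with hF
  obtain ⟨a, haT, ha⟩ := mem_nhdsLT_iff_exists_Ioo_subset.1 hD
  refine tendsto_integral_norm_sub_sq_of_frequently_l4Bound_lt hν hT hcl hLH hdec fun δ hδ => ?_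
  -- `Φ(T − t) → 0`
  have hsub : Tendsto (fun t : ℝ => T - t) (𝓝[<] T) (𝓝 0) := by
    have h : Tendsto (fun t : ℝ => T - t) (𝓝 T) (𝓝 (T - T)) := tendsto_const_nhds.sub tendsto_id
    rw [sub_self] at h
    exact tendsto_nhdsWithin_of_tendsto_nhds h
  have hpow : ∀ e : ℝ, 0 < e → Tendsto (fun t : ℝ => (T - t) ^ e) (𝓝[<] T) (𝓝 0) := by
    intro e he
    have h := hsub.rpow_const (p := e) (Or.inr he.le)
    rwa [Real.zero_rpow he.ne'] at h
  have hΦ : Tendsto (fun t : ℝ => A₁ * (T - t) ^ γ + A₂ * (T - t) ^ e₂) (𝓝[<] T) (𝓝 0) := by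
    have h := ((hpow γ hγ0).const_mul A₁).add ((hpow e₂ he₂0).const_mul A₂)
    simpa using h
  have hΦev : ∀ᶠ t in 𝓝[<] T, A₁ * (T - t) ^ γ + A₂ * (T - t) ^ e₂ < δ :=
    hΦ.eventually (gt_mem_nhds hδ)
  obtain ⟨a₁, ha₁T, ha₁⟩ := mem_nhdsLT_iff_exists_Ioo_subset.1 hΦev
  -- frequently: inside every `U ∈ 𝓝[<] T`
  rw [Filter.frequently_iff]
  intro U hU
  obtain ⟨a₂, ha₂T, ha₂⟩ := mem_nhdsLT_iff_exists_Ioo_subset.1 hU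
  -- a base time `t` close to `T`
  set m : ℝ := max (max a a₁) (max a₂ 0) with hm
  have hmT : m < T := max_lt (max_lt haT ha₁T) (max_lt ha₂T hT)
  set t : ℝ := (m + T) / 2 with htdef
  have hmt : m < t := by rw [htdef]; linarith
  have htT : t < T := by rw [htdef]; linarith
  have hat : a < t := lt_of_le_of_lt ((le_max_left _ _).trans (le_max_left _ _)) hmt
  have ha₁t : a₁ < t := lt_of_le_of_lt ((le_max_right _ _).trans (le_max_left _ _)) hmt
  have ha₂t : a₂ < t := lt_of_le_of_lt ((le_max_left _ _).trans (le_max_right _ _)) hmt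
  have h0t : 0 < t := lt_of_le_of_lt ((le_max_right _ _).trans (le_max_right _ _)) hmt
  have hTt : 0 < T - t := sub_pos.2 htT
  -- Chebyshev slice in the half window `W = (t, (t+T)/2)`
  set s₀ : ℝ := (t + T) / 2 with hs₀
  have hts₀ : t < s₀ := by rw [hs₀]; linarith
  have hs₀T : s₀ < T := by rw [hs₀]; linarith
  set lam₀ : ℝ := 4 * K' * (T - t) ^ (γ - 1) with hlam₀
  have hlam₀0 : 0 < lam₀ := by positivity
  have hDt : ∫⁻ τ in Ioo t T, F τ ≤ ENNReal.ofReal (K * (T - t) ^ γ) := ha ⟨hat, htT⟩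
  have hslice : ∃ τ ∈ Ioo t s₀, ∫ x, frobeniusNormSq (fderiv ℝ (u τ) x) < lam₀ := by
    by_contra hcon
    push Not at hcon
    have hlow : ENNReal.ofReal (lam₀ * (s₀ - t)) ≤ ∫⁻ τ in Ioo t s₀, F τ := by
      have h1 : ∫⁻ _ in Ioo t s₀, ENNReal.ofReal lam₀ ≤ ∫⁻ τ in Ioo t s₀, F τ :=
        setLIntegral_mono' measurableSet_Ioo fun τ hτ =>
          (ENNReal.ofReal_le_ofReal (hcon τ hτ)).trans (Literature.MathematicalPhysics.KineticTheory.ofReal_integral_le_lintegral _)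
      rwa [setLIntegral_const, Real.volume_Ioo, ← ENNReal.ofReal_mul hlam₀0.le] at h1
    have hup : ∫⁻ τ in Ioo t s₀, F τ ≤ ENNReal.ofReal (K * (T - t) ^ γ) :=
      (lintegral_mono_set (Ioo_subset_Ioo_right hs₀T.le)).trans hDt
    have hval : lam₀ * (s₀ - t) = 2 * K' * (T - t) ^ γ := by
      have e : s₀ - t = (T - t) / 2 := by rw [hs₀]; ring
      rw [hlam₀, e, show γ = (γ - 1) + 1 by ring, Real.rpow_add hTt, Real.rpow_one]
      ring_nf
    have hlt : K * (T - t) ^ γ < lam₀ * (s₀ - t) := by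
      rw [hval, hK']
      have : 0 < (T - t) ^ γ := Real.rpow_pos_of_pos hTt _
      nlinarith
    have := (hlow.trans hup)
    rw [ENNReal.ofReal_le_ofReal_iff (by positivity)] at this
    linarith
  obtain ⟨τ, hτW, hZτ⟩ := hslice
  have hτT : τ < T := hτW.2.trans hs₀T
  have htτ : t < τ := hτW.1
  have hTτ : 0 < T - τ := sub_pos.2 hτT
  have hTτle : T - τ ≤ T - t := by linarith
  refine ⟨τ, ha₂ ⟨ha₂t.trans htτ, hτT⟩, ?_⟩
  -- the `L⁴` tail at `τ`
  set Z : ℝ := ∫ x, frobeniusNormSq (fderiv ℝ (u τ) x) with hZdef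
  have hZ0 : 0 ≤ Z := integral_nonneg fun x => frobeniusNormSq_nonneg _
  set lam : ℝ := (T - τ) ^ ((1 - γ) / 4) with hlamdef
  have hlam : 0 < lam := Real.rpow_pos_of_pos hTτ _
  set L : ℝ≥0∞ := ∫⁻ σ in Ioo τ T, ENNReal.ofReal (Real.sqrt (∫ x, ‖u σ x‖ ^ 4)) with hL
  have hDτ : ∫⁻ σ in Ioo τ T, F σ ≤ ENNReal.ofReal (K * (T - τ) ^ γ) := ha ⟨hat.trans htτ, hτT⟩
  have hLle : L ≤ ENNReal.ofReal (c₁ * (T - τ) ^ ((1 + 3 * γ) / 4)) := by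
    refine lintegral_Ioo_le_of_forall_Ioo_le hτT fun s hs => ?_
    have h := lintegral_sqrt_l4_le_of_young hν hT hcl hLH hdec (h0t.trans htτ) hs.1 hs.2 hlam
    rw [← hKc, ← hE₀, ← hc] at h
    refine h.trans ?_
    have h1 : ENNReal.ofReal (c * (3 / 4 * lam)) * (∫⁻ σ in Ioo τ s, F σ) ≤
        ENNReal.ofReal (c * (3 / 4 * lam) * (K * (T - τ) ^ γ)) := by
      rw [ENNReal.ofReal_mul (by positivity : 0 ≤ c * (3 / 4 * lam))]
      exact mul_le_mul' le_rfl ((lintegral_mono_set (Ioo_subset_Ioo_right hs.2.le)).trans hDτ)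
    have h2 : ENNReal.ofReal (c * (1 / 4 * lam ^ (-3 : ℝ)) * (s - τ)) ≤
        ENNReal.ofReal (c * (1 / 4 * lam ^ (-3 : ℝ)) * (T - τ)) :=
      ENNReal.ofReal_le_ofReal (mul_le_mul_of_nonneg_left (by linarith [hs.2])
        (by positivity))
    refine (add_le_add h1 h2).trans ?_
    rw [← ENNReal.ofReal_add (by positivity) (by positivity)]
    refine ENNReal.ofReal_le_ofReal (le_of_eq ?_)
    -- exponent bookkeeping: `λ(T−τ)^γ = (T−τ)^{(1+3γ)/4} = λ^{−3}(T−τ)`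
    have e1 : lam * (T - τ) ^ γ = (T - τ) ^ ((1 + 3 * γ) / 4) := by
      rw [hlamdef, ← Real.rpow_add hTτ]; congr 1; ring
    have e2 : lam ^ (-3 : ℝ) * (T - τ) = (T - τ) ^ ((1 + 3 * γ) / 4) := by
      rw [hlamdef, ← Real.rpow_mul hTτ.le]
      conv_lhs => rw [show (T - τ) = (T - τ) ^ (1 : ℝ) by rw [Real.rpow_one]]
      rw [← Real.rpow_mul hTτ.le, ← Real.rpow_add hTτ]
      congr 1; ring
    rw [hc₁]
    calc c * (3 / 4 * lam) * (K * (T - τ) ^ γ) + c * (1 / 4 * lam ^ (-3 : ℝ)) * (T - τ)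
        = c * (3 / 4) * K * (lam * (T - τ) ^ γ) + c * (1 / 4) * (lam ^ (-3 : ℝ) * (T - τ)) := by
          ring
      _ = (c * (3 / 4) * K + c * (1 / 4)) * (T - τ) ^ ((1 + 3 * γ) / 4) := by rw [e1, e2]; ring
  have hLfin : L ≠ ⊤ := ne_top_of_le_ne_top ENNReal.ofReal_ne_top hLle
  have hLreal : L.toReal ≤ c₁ * (T - τ) ^ ((1 + 3 * γ) / 4) := by
    have := (ENNReal.toReal_le_toReal hLfin ENNReal.ofReal_ne_top).2 hLle
    rwa [ENNReal.toReal_ofReal (by positivity)] at this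
  refine ⟨hLfin, ?_⟩
  -- first term: `(ν/2)(T−τ)Z(τ) ≤ A₁ (T−t)^γ`
  have h1 : ν / 2 * ((T - τ) * Z) ≤ A₁ * (T - t) ^ γ := by
    have hw : (T - τ) * Z ≤ (T - t) * lam₀ :=
      mul_le_mul hTτle hZτ.le hZ0 hTt.le
    have e : (T - t) * lam₀ = 4 * K' * (T - t) ^ γ := by
      rw [hlam₀, show γ = (γ - 1) + 1 by ring, Real.rpow_add hTt, Real.rpow_one]; ring_nf
    rw [hA₁]
    calc ν / 2 * ((T - τ) * Z) ≤ ν / 2 * ((T - t) * lam₀) :=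
          mul_le_mul_of_nonneg_left hw (by positivity)
      _ = ν / 2 * (4 * K') * (T - t) ^ γ := by rw [e]; ring
  -- second term: `2√Z L ≤ A₂ (T−t)^{e₂}`
  have hsqrtZ : Real.sqrt Z ≤ Real.sqrt (4 * K') * (T - τ) ^ ((γ - 1) / 2) := by
    have hZle : Z ≤ 4 * K' * (T - τ) ^ (γ - 1) := by
      refine hZτ.le.trans ?_
      rw [hlam₀]
      exact mul_le_mul_of_nonneg_left
        (Real.rpow_le_rpow_of_nonpos hTτ hTτle (by linarith)) (by positivity)
    calc Real.sqrt Z ≤ Real.sqrt (4 * K' * (T - τ) ^ (γ - 1)) := Real.sqrt_le_sqrt hZle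
      _ = Real.sqrt (4 * K') * (T - τ) ^ ((γ - 1) / 2) := by
          rw [Real.sqrt_mul (by positivity), Real.sqrt_eq_rpow ((T - τ) ^ (γ - 1)),
            ← Real.rpow_mul hTτ.le]
          congr 2; ring
  have h2 : 2 * (Real.sqrt Z * L.toReal) ≤ A₂ * (T - t) ^ e₂ := by
    have hprod : Real.sqrt Z * L.toReal ≤
        Real.sqrt (4 * K') * c₁ * (T - τ) ^ e₂ := by
      calc Real.sqrt Z * L.toReal
          ≤ (Real.sqrt (4 * K') * (T - τ) ^ ((γ - 1) / 2)) * (c₁ * (T - τ) ^ ((1 + 3 * γ) / 4)) :=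
            mul_le_mul hsqrtZ hLreal ENNReal.toReal_nonneg (by positivity)
        _ = Real.sqrt (4 * K') * c₁ * ((T - τ) ^ ((γ - 1) / 2) * (T - τ) ^ ((1 + 3 * γ) / 4)) := by
            ring
        _ = Real.sqrt (4 * K') * c₁ * (T - τ) ^ e₂ := by
            rw [← Real.rpow_add hTτ, he₂]; congr 2; ring
    have hmono : (T - τ) ^ e₂ ≤ (T - t) ^ e₂ := Real.rpow_le_rpow hTτ.le hTτle he₂0.le
    rw [hA₂]
    calc 2 * (Real.sqrt Z * L.toReal) ≤ 2 * (Real.sqrt (4 * K') * c₁ * (T - τ) ^ e₂) :=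
          mul_le_mul_of_nonneg_left hprod (by norm_num)
      _ ≤ 2 * (Real.sqrt (4 * K') * c₁ * (T - t) ^ e₂) :=
          mul_le_mul_of_nonneg_left (mul_le_mul_of_nonneg_left hmono (by positivity)) (by norm_num)
      _ = 2 * (Real.sqrt (4 * K') * c₁) * (T - t) ^ e₂ := by ring
  have hΦt : A₁ * (T - t) ^ γ + A₂ * (T - t) ^ e₂ < δ := ha₁ ⟨ha₁t, htT⟩
  linarith [h1, h2, hΦt]

end NoTerminalJolt

end Summit.NavierStokesRegularity.NavierStokesRegularity.Theorems

end
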